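import Mathlib.Analysis.SpecialFunctions.Pow.Real
import Mathlib.Topology.Order.IntermediateValue
import Mathlib.Algebra.Order.Ring.Pow
import Mathlib.Topology.Algebra.Polynomial
import Mathlib.Analysis.SpecialFunctions.Log.Basic
import HarnessLib

/-!
# The balancing weight of Achlioptas–Peres: a root of `ε (2-ε)^{k-1} = 1` near `2^{1-k}`

AP2004 (D. Achlioptas, Y. Peres, J. Amer. Math. Soc. 17 (2004); arXiv:cs/0305009) choose the
weight parameter `ε = ε₀` by the balance equation (23)/(47), `ε (2-ε)^{k-1} = 1`, and record the
enclosure (26): `2^{1-k} + k 4^{-k} < ε₀ < 2^{1-k} + 3k 4^{-k}`, proved by evaluating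
`q(x) = x - (2-x)^{1-k}` at the two endpoints. We prove the existence of such a root with the
slightly cruder (and all we need) enclosure `2^{1-k} ≤ ε₀ ≤ 2^{1-k}(1 + 4k 2^{-k})` for every
`k ≥ 4`, by the intermediate value theorem for `g(x) = x (2-x)^{k-1}` on that interval
(`g(2^{1-k}) = (1 - 2^{-k})^{k-1} ≤ 1` and, by Bernoulli, `g ≥ 1` at the right end). In terms of
`λ = 1 - ε` (the variable of `RandomKSatWeights.lean`, `λ = γ²`) the balance equation reads
`(1+λ)^{k-1}(1-λ) = 1`.

## Results (all proved, no definitions: the root is provided existentially)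

* `exists_balance_eps` — for `k ≥ 4` there is `ε` with `ε (2-ε)^{k-1} = 1` and
  `2/2^k ≤ ε ≤ 2/2^k + 8k/4^k`;
* `exists_balance_lam` — the same for `λ = 1 - ε`: `0 < λ < 1`, `(1+λ)^{k-1}(1-λ) = 1`,
  `2/2^k ≤ 1 - λ ≤ 2/2^k + 8k/4^k`.
-/

noncomputable section

namespace Literature.Computability.Complexity

namespace RandomKSat

open Set

/-- `4k ≤ 2^k` for `k ≥ 4`. [folklore] -/
theorem four_mul_le_two_pow {k : ℕ} (hk : 4 ≤ k) : 4 * (k : ℝ) ≤ 2 ^ k := by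
  have h : ∀ n : ℕ, 4 * ((n + 4 : ℕ) : ℝ) ≤ 2 ^ (n + 4) := by
    intro n
    induction n with
    | zero => norm_num
    | succ n ih =>
      have : (2 : ℝ) ^ (n + 1 + 4) = 2 * 2 ^ (n + 4) := by ring
      rw [this]; push_cast at ih ⊢; nlinarith
  obtain ⟨n, rfl⟩ : ∃ n, k = n + 4 := ⟨k - 4, by omega⟩
  exact h n

/-- **The balancing `ε₀`** (AP (23)/(47) with the enclosure of (26) in cruder form): for `k ≥ 4`
there is `ε` with `ε (2-ε)^{k-1} = 1` and `2/2^k ≤ ε ≤ 2/2^k + 8k/4^k`.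
[cite: AchlioptasPeres2004, eq. (23) p. 10, (26) p. 11, (47) p. 15] -/
theorem exists_balance_eps {k : ℕ} (hk : 4 ≤ k) :
    ∃ ε : ℝ, ε * (2 - ε) ^ (k - 1) = 1 ∧ 2 / 2 ^ k ≤ ε ∧ ε ≤ 2 / 2 ^ k + 8 * k / 4 ^ k := by
  set a : ℝ := 2 / 2 ^ k with ha
  set t : ℝ := 4 * k / 2 ^ k with ht
  set b : ℝ := a * (1 + t) with hb
  have h2k : (0 : ℝ) < 2 ^ k := pow_pos two_pos k
  have ha0 : 0 < a := by positivity
  have ht0 : 0 ≤ t := by positivity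
  have ht1 : t ≤ 1 := by
    rw [ht, div_le_one h2k]; exact four_mul_le_two_pow hk
  have hab : a ≤ b := by rw [hb]; nlinarith
  -- `g(x) = x (2-x)^{k-1}` is continuous
  have hcont : ContinuousOn (fun x : ℝ => x * (2 - x) ^ (k - 1)) (Icc a b) :=
    (continuous_id.mul ((continuous_const.sub continuous_id).pow _)).continuousOn
  -- left end: `g(a) = (1 - 2^{-k})^{k-1} ≤ 1`
  have hga : a * (2 - a) ^ (k - 1) ≤ 1 := by
    have e : a * (2 - a) ^ (k - 1) = (1 - 1 / 2 ^ k) ^ (k - 1) := by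
      have h2 : (2 : ℝ) - a = 2 * (1 - 1 / 2 ^ k) := by rw [ha]; ring
      rw [h2, mul_pow, ← mul_assoc]
      have : a * 2 ^ (k - 1) = 1 := by
        rw [ha]
        have : (2 : ℝ) ^ k = 2 * 2 ^ (k - 1) := by
          rw [← pow_succ']; congr 1; omega
        rw [this]; field_simp
      rw [this, one_mul]
    rw [e]
    have hle : (1 : ℝ) / 2 ^ k ≤ 1 := by
      rw [div_le_one h2k]; exact one_le_pow₀ (by norm_num)
    have hge : (0 : ℝ) < 1 / 2 ^ k := by positivity
    exact pow_le_one₀ (by linarith) (by linarith)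
  -- right end: `g(b) ≥ 1` by Bernoulli
  have hgb : 1 ≤ b * (2 - b) ^ (k - 1) := by
    have hy0 : 0 ≤ b / 2 := by positivity
    have hb2 : b = 2 * (b / 2) := by ring
    have h2b : (2 : ℝ) - b = 2 * (1 - b / 2) := by ring
    -- `b/2 = (1+t)/2^k ≤ 2/2^k ≤ 1/2`
    have hy1 : b / 2 ≤ 1 := by
      rw [hb, ha]
      have : 2 / 2 ^ k * (1 + t) / 2 = (1 + t) / 2 ^ k := by field_simp
      rw [this, div_le_one h2k]
      have : (4 : ℝ) ≤ 2 ^ k := le_trans (by nlinarith [show (4 : ℝ) ≤ k by exact_mod_cast hk])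
        (four_mul_le_two_pow hk)
      linarith
    have hbern : 1 - ((k - 1 : ℕ) : ℝ) * (b / 2) ≤ (1 - b / 2) ^ (k - 1) := by
      have h := one_add_mul_le_pow (show (-2 : ℝ) ≤ -(b / 2) by linarith) (k - 1)
      have e1 : (1 : ℝ) + -(b / 2) = 1 - b / 2 := by ring
      have e2 : (1 : ℝ) + ((k - 1 : ℕ) : ℝ) * -(b / 2) = 1 - ((k - 1 : ℕ) : ℝ) * (b / 2) := by ring
      rw [e1, e2] at h
      exact h
    have epow : b * (2 - b) ^ (k - 1) = (1 + t) * (1 - b / 2) ^ (k - 1) := by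
      rw [h2b, mul_pow]
      have e2 : (2 : ℝ) ^ (k - 1) = 2 ^ k / 2 := by
        have : (2 : ℝ) ^ k = 2 * 2 ^ (k - 1) := by rw [← pow_succ']; congr 1; omega
        rw [this]; field_simp
      rw [e2, hb, ha]; field_simp
    rw [epow]
    have hk1 : ((k - 1 : ℕ) : ℝ) ≤ k := by exact_mod_cast Nat.sub_le k 1
    have hk0 : (0 : ℝ) ≤ ((k - 1 : ℕ) : ℝ) := Nat.cast_nonneg _
    -- `(1+t)(1 - (k-1) b/2) ≥ 1` since `t = 4k/2^k` and `b/2 = (1+t)/2^k`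
    have hy : b / 2 = (1 + t) / 2 ^ k := by rw [hb, ha]; field_simp
    have hkey : 1 ≤ (1 + t) * (1 - ((k - 1 : ℕ) : ℝ) * (b / 2)) := by
      rw [hy]
      -- goal: 1 ≤ (1+t)(1 - (k-1)(1+t)/2^k); with t 2^k = 4k and (1+t)² ≤ 4
      have htk : t * 2 ^ k = 4 * k := by rw [ht]; field_simp
      rw [show (1 + t) * (1 - ((k - 1 : ℕ) : ℝ) * ((1 + t) / 2 ^ k)) =
        1 + (t * 2 ^ k - ((k - 1 : ℕ) : ℝ) * (1 + t) ^ 2) / 2 ^ k by field_simp; ring]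
      have : 0 ≤ (t * 2 ^ k - ((k - 1 : ℕ) : ℝ) * (1 + t) ^ 2) / 2 ^ k := by
        apply div_nonneg _ h2k.le
        rw [htk]
        have hsq : (1 + t) ^ 2 ≤ 4 := by nlinarith
        have := mul_le_mul_of_nonneg_left hsq hk0
        nlinarith
      linarith
    have hpos1 : 0 ≤ 1 + t := by linarith
    calc (1 : ℝ) ≤ (1 + t) * (1 - ((k - 1 : ℕ) : ℝ) * (b / 2)) := hkey
      _ ≤ (1 + t) * (1 - b / 2) ^ (k - 1) := mul_le_mul_of_nonneg_left hbern hpos1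
  -- intermediate value theorem
  have hmem : (1 : ℝ) ∈ Icc (a * (2 - a) ^ (k - 1)) (b * (2 - b) ^ (k - 1)) := ⟨hga, hgb⟩
  obtain ⟨ε, ⟨hεa, hεb⟩, hε⟩ := intermediate_value_Icc hab hcont hmem
  refine ⟨ε, hε, by rw [ha] at hεa; exact hεa, ?_⟩
  calc ε ≤ b := hεb
    _ = 2 / 2 ^ k + 8 * k / 4 ^ k := by
        rw [hb, ha, ht]
        have : (4 : ℝ) ^ k = 2 ^ k * 2 ^ k := by rw [← mul_pow]; norm_num
        rw [this]; field_simp; ring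

/-- **The balancing `λ₀ = 1 - ε₀`**: for `k ≥ 4` there is `λ ∈ (0, 1)` with
`(1+λ)^{k-1}(1-λ) = 1` (the balance equation of `RandomKSatBalancedFirstMoment.lean`) and
`2/2^k ≤ 1 - λ ≤ 2/2^k + 8k/4^k`. [cite: AchlioptasPeres2004, eq. (23) p. 10, (26) p. 11, (47) p. 15] -/
theorem exists_balance_lam {k : ℕ} (hk : 4 ≤ k) :
    ∃ lam : ℝ, 0 < lam ∧ lam < 1 ∧ (1 + lam) ^ (k - 1) * (1 - lam) = 1 ∧
      2 / 2 ^ k ≤ 1 - lam ∧ 1 - lam ≤ 2 / 2 ^ k + 8 * k / 4 ^ k := by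
  obtain ⟨ε, hε, h1, h2⟩ := exists_balance_eps hk
  have h2k : (0 : ℝ) < 2 ^ k := pow_pos two_pos k
  have h4k : (0 : ℝ) < 4 ^ k := pow_pos (by norm_num) k
  refine ⟨1 - ε, ?_, ?_, ?_, by linarith, by linarith⟩
  · -- `ε ≤ 2/2^k + 8k/4^k < 1`
    have h16 : (16 : ℝ) ≤ 2 ^ k := by
      calc (16 : ℝ) = 2 ^ 4 := by norm_num
        _ ≤ 2 ^ k := pow_le_pow_right₀ (by norm_num) hk
    have hA : 2 / (2 : ℝ) ^ k ≤ 1 / 8 := by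
      rw [div_le_div_iff₀ h2k (by norm_num)]; linarith
    have hB : 8 * (k : ℝ) / 4 ^ k ≤ 1 / 2 := by
      rw [div_le_div_iff₀ h4k (by norm_num)]
      have : (4 : ℝ) ^ k = 2 ^ k * 2 ^ k := by rw [← mul_pow]; norm_num
      have h4 := four_mul_le_two_pow hk
      rw [this]; nlinarith
    linarith
  · have : 0 < 2 / (2 : ℝ) ^ k := by positivity
    linarith
  · have e : (1 : ℝ) + (1 - ε) = 2 - ε := by ring
    have e2 : (1 : ℝ) - (1 - ε) = ε := by ring
    rw [e, e2, mul_comm]; exact hε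

end RandomKSat

end Literature.Computability.Complexity

end
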